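import Literature.NumberTheory.EllipticCurves.YanZhu2026.OrdinaryMainConjectureEqualityProofs
import Literature.NumberTheory.EllipticCurves.CyclotomicIwasawaMainTheoremIrreducibleBaseChangeProofs
import Literature.NumberTheory.QuadraticFields.FundamentalDiscriminant
import Mathlib.NumberTheory.NumberField.Discriminant.Different
import HarnessLib

/-!
# Good ordinary reduction of a minimal model of `E^K` at a prime split in `K`, and the (Im) clause
of Yan–Zhu Theorem 4.2 (1) with every `E^K`-side hypothesis discharged by name

[cite: YanZhu2024MainConjNonCM, Thm. 4.2 (1) and its proof (arXiv:2412.20078v4 TeX l.1050–1056)]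
[cite: Knapp1993, Prop. 12.10] [cite: SilvermanAEC2009, VII.5 Prop. 5.1(a), X.5 Cor. 5.4]
[cite: NeukirchANT1999, Ch. III Cor. (2.12)]

A LEAF over `YanZhu2026/OrdinaryMainConjectureEqualityProofs.lean` §D (kept separate because the
ordinary-reduction transfer lives in `CyclotomicIwasawaMainTheoremIrreducibleBaseChangeProofs.lean`,
whose closure the core file does not need).

* `isOrdinaryAt_of_smul_eq_quadraticTwist_discr` — for a quadratic field `K`, globally minimal `W, W'`
  with `C • W' = W^{(d_K)}`, and an odd prime `p ∤ d_K`: `W` good ordinary at `p` ⟹ `W'` good ordinary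
  at `p`. Print: "`E^K` has good ordinary reduction at `p ∤ 2 d_K` when `E` does" (`a_p(E^K) = χ_K(p) a_p(E)`,
  Knapp Prop. 12.10). Proof: `d_K` is squarefree or `4 m` with `m` squarefree
  (`Quadratic.isFundamentalDiscriminant_discr`); in the second case `W^{(d_K)} = W^{(m·2²)} ≅ W^{(m)}`
  (`exists_variableChange_quadraticTwist_mul_sq`), and the tree's `isOrdinaryAt_of_smul_eq_quadraticTwist`
  (squarefree twisting parameter prime to `p`) applies to `m`.
* `not_dvd_discr_of_ncard_primesOver_eq_two` — a prime with two primes of `𝓞 K` above it is unramified,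
  so `p ∤ d_K` (Dedekind's discriminant theorem, Neukirch ANT III (2.12); the tree's
  `not_dvd_discr_of_ncard_primesOver` in
  `PAdicGrossZagierConstantTermProofs.lean`, re-proved in 8 lines rather than importing the `p`-adic
  Gross–Zagier closure).
* `YanZhu2026.spanLeIdeal_perrinRiou_of_facts_of_minimalTwist_of_split` — §D of the core file with
  `GoodOrd W' p` DISCHARGED: under the standing hypotheses of Thm. 4.2 (`p ≥ 3` split in `K`, `E` good
  ordinary at `p`, `E[p]` irreducible, (Im) for `E`), granted (DIV) and the three named inputs
  (`thm49_…_integral`, `lemma53_…`, `prop37_…_mul`), the (Im)-clause inclusion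
  `(𝓛_p^PR) ⊂ Char(X_ord)` holds for ANY globally minimal model `W'` of `E^K` with its newform `g` and
  Néron ratio `ϖ'` — no hypothesis on `E^K` beyond these data. WEAKER than print by exactly: (DIV) a
  hypothesis (or the gen-5 Greenberg inputs, core file §C). Never stronger.
-/

noncomputable section

open scoped Classical

open PowerSeries NumberField IsDedekindDomain Field CongruenceSubgroup
  Literature.NumberTheory.GaloisRepresentations Literature.NumberTheory.EllipticCurves
  Literature.NumberTheory.EllipticCurves.ModularForms Literature.NumberTheory.EllipticCurves.Rank1Residual

namespace Literature.NumberTheory.EllipticCurves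

/-! ## §1. Arithmetic of the quadratic field: split primes are prime to `d_K` -/

/-- **A prime with `[K:ℚ] = 2` primes above it does not divide `d_K`.** Each prime above `p` has
ramification index `1` (fundamental identity, tree
`QuadraticFields.SplitPrime.ramificationIdx_eq_one_of_ncard_primesOver`), so `p` is unramified in `𝓞 K`,
i.e. `p ∤ d_K` by Dedekind's discriminant theorem (Mathlib `NumberField.not_dvd_discr_iff_isUnramifiedIn`).
Same statement and proof as the tree's `not_dvd_discr_of_ncard_primesOver`
(`PAdicGrossZagierConstantTermProofs.lean`), specialised to degree `2`.
[cite: NeukirchANT1999, Ch. III Cor. (2.12)] -/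
theorem not_dvd_discr_of_ncard_primesOver_eq_two {K : Type*} [Field K] [NumberField K]
    (h2 : Module.finrank ℚ K = 2) {p : ℕ} (hp : p.Prime)
    (h : ((Ideal.span {(p : ℤ)}).primesOver (𝓞 K)).ncard = 2) :
    ¬ (p : ℤ) ∣ NumberField.discr K := by
  have hpZ : Prime (p : ℤ) := Nat.prime_iff_prime_int.mp hp
  rw [NumberField.not_dvd_discr_iff_isUnramifiedIn K (𝓞 K) hpZ,
    Algebra.isUnramifiedIn_iff_forall_ramificationIdx_eq_one]
  intro P _ hP
  have hmem : P ∈ (Ideal.span {(p : ℤ)}).primesOver (𝓞 K) := ⟨‹P.IsPrime›, hP⟩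
  have he := (Literature.NumberTheory.QuadraticFields.SplitPrime.ramificationIdx_eq_one_of_ncard_primesOver
    hp (h.trans h2.symm) hmem).1
  rwa [Ideal.ramificationIdx'_eq_ramificationIdx (Ideal.span {(p : ℤ)}) P
    (by simpa using hpZ.ne_zero)] at he

/-! ## §2. Good ordinary reduction of a minimal model of `E^{(d_K)}` -/

/-- **A globally minimal model of `E^{(d_K)}` is good ordinary at every odd good ordinary prime
`p ∤ d_K` of `E`.** For a quadratic field `K`, `d_K` is either squarefree or `4m` with `m` squarefree
(`Quadratic.isFundamentalDiscriminant_discr`); in the latter case `W^{(d_K)} = W^{(m · 2²)} ≅ W^{(m)}` over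
`ℚ` (`exists_variableChange_quadraticTwist_mul_sq`), so in both cases `W'` is a globally minimal model
of a twist by a SQUAREFREE integer prime to `p`, and the tree's
`isOrdinaryAt_of_smul_eq_quadraticTwist` (Silverman VII.5 Prop. 5.1(a) + `a_p(E^d) = (d/p) a_p(E)`,
Knapp Prop. 12.10) applies. [cite: Knapp1993, Prop. 12.10] -/
theorem isOrdinaryAt_of_smul_eq_quadraticTwist_discr {K : Type*} [Field K] [NumberField K]
    (h2 : Module.finrank ℚ K = 2) (W W' : WeierstrassCurve ℚ) [W.IsElliptic] [W.IsGloballyMinimal]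
    [W'.IsGloballyMinimal] {C : WeierstrassCurve.VariableChange ℚ}
    (hC : C • W' = W.quadraticTwist (NumberField.discr K : ℚ)) (p : ℕ) [Fact p.Prime] (hp2 : p ≠ 2)
    (hpd : ¬ (p : ℤ) ∣ NumberField.discr K) (hW : IsOrdinaryAt W p) : IsOrdinaryAt W' p := by
  rcases Literature.NumberTheory.QuadraticFields.Quadratic.isFundamentalDiscriminant_discr h2 with
    ⟨-, hsq, -⟩ | ⟨h4, -, hsq⟩
  · exact isOrdinaryAt_of_smul_eq_quadraticTwist W W' hsq hC p hp2 hpd hW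
  · -- `d_K = 4 m`, `m = d_K / 4` squarefree: `W^{(d_K)} = W^{(m · 2²)} ≅ W^{(m)}`
    set m : ℤ := NumberField.discr K / 4 with hm
    have hdm : NumberField.discr K = m * 2 ^ 2 := by
      rw [hm]; have := Int.ediv_mul_cancel h4; omega
    obtain ⟨C₂, hC₂⟩ := W.exists_variableChange_quadraticTwist_mul_sq (m : ℚ) 2 two_ne_zero
    have hcast : ((NumberField.discr K : ℤ) : ℚ) = (m : ℚ) * 2 ^ 2 := by rw [hdm]; push_cast; ring
    have hC' : (C₂⁻¹ * C) • W' = W.quadraticTwist (m : ℚ) := by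
      rw [mul_smul, hC, hcast, ← hC₂, inv_smul_smul]
    have hpm : ¬ (p : ℤ) ∣ m := fun h ↦ hpd (hdm ▸ dvd_mul_of_dvd_left h _)
    exact isOrdinaryAt_of_smul_eq_quadraticTwist W W' hsq hC' p hp2 hpm hW

namespace YanZhu2026

open IwasawaAlgebra₂ UnrSeries₂ GreenbergVatsal2000 BurungaleCastellaSkinner2025

variable {p : ℕ} [Fact p.Prime]

/-! ## §3. The (Im) clause of Theorem 4.2 (1), `E^K`-side hypotheses all discharged -/

/-- **Yan–Zhu Theorem 4.2 (1), (Im) clause — `(𝓛_p^PR(E/K)) ⊂ Char_{Λ_K}(𝒳_ord(E/K_∞))` — granted (DIV)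
and the three named inputs, with NO hypothesis on `E^K` beyond the data of a globally minimal model `W'`
of `E^{(d_K)}`, its newform `g` (level `N_{E^K}`) and Néron ratio `ϖ'`.** As
`spanLeIdeal_perrinRiou_of_facts_of_minimalTwist` (core file §D), with `GoodOrd W' p` now DERIVED:
`p` splits in `K` (`hsplit`) so `p ∤ d_K` (`not_dvd_discr_of_ncard_primesOver_eq_two`), `p ≥ 3`, and
good ordinary reduction passes from `E` to the minimal model of `E^{(d_K)}`
(`isOrdinaryAt_of_smul_eq_quadraticTwist_discr`). This is the last paragraph of the printed proof of
Thm. 4.2 ([Kato, Thm. 17.4] for `E^K`, Lemma 5.3, [SU14, Lemma 3.2]) with every input about `E^K` by name.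
[cite: YanZhu2024MainConjNonCM, Thm. 4.2 (1) (Im) clause (arXiv:2412.20078v4 TeX l.944–949) and its proof l.1050–1056] -/
theorem spanLeIdeal_perrinRiou_of_facts_of_minimalTwist_of_split
    (h49 : thm49_charIdeal_eq_padicLFunction_integral)
    (h53 : lemma53_charIdeal_mul_charIdeal_le_toPlus_charIdeal)
    (h37 : prop37_cycRestrict_perrinRiou_eq_padicLFunction_mul)
    (ι : integralClosure ℚ ℂ →+* ℂ_[p]) (W : WeierstrassCurve ℚ) [W.IsElliptic] [W.IsGloballyMinimal]
    (K : Type) [Field K] [NumberField K] (κ₁ κ₂ : ZpExtension K p) (γ₁ γ₂ : absoluteGaloisGroup K)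
    [Fact (ZpExtension.IsTopGeneratorPair κ₁ κ₂ γ₁ γ₂)] {N : ℕ} [NeZero N]
    (π : ModularParametrizationData W N) (κ : ZpExtension ℚ p)
    (D : W.SelmerDualData κ (absGaloisRestrict ℚ K γ₁))
    (D' : (W.quadraticTwist (NumberField.discr K : ℚ)).SelmerDualData κ (absGaloisRestrict ℚ K γ₁))
    (ϖ : ℚ) (W' : WeierstrassCurve ℚ) [W'.IsElliptic] [W'.IsGloballyMinimal]
    [NeZero (W'.conductorNorm ℤ)] (g : CuspForm (Gamma0 (W'.conductorNorm ℤ)) 2) (ϖ' : ℚ)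
    (hlevel : (N : ℤ) = W.conductorNorm ℤ) (hp : 3 ≤ p) (hord : GoodOrd W p) (hirr : Irr W p)
    (him : BigIm W p) (hK : IsImaginaryQuadratic K)
    (hsplit : ((Ideal.span {(p : ℤ)}).primesOver (𝓞 K)).ncard = 2)
    (hN : IsCoprime (N : ℤ) (NumberField.discr K))
    (hirrK : (W.baseChange K).HasIrreducibleModPGaloisRep p)
    (hκ₁ : κ₁.IsCyclotomic) (hκ₂ : κ₂.IsAnticyclotomic) (hκ : κ.IsCyclotomic)
    (hγ : κ.IsTopGenerator (absGaloisRestrict ℚ K γ₁))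
    (hγ' : IsCyclotomicVariable p (absGaloisRestrict ℚ K γ₁))
    (hϖ : (ϖ : ℝ) * W.realPeriodRat = plusPeriod π.f)
    (hW' : ∃ C : WeierstrassCurve.VariableChange ℚ, C • W' = W.quadraticTwist (NumberField.discr K : ℚ))
    (hg : IsNewformOf W' g) (hϖ' : (ϖ' : ℝ) * W'.realPeriodRat = plusPeriod g)
    {F : CycAntiSeries p} (hF : IsHidaRankinLFunction ι W κ₁ κ₂ π.f F)
    (hdiv : IdealLeSpan (WeierstrassCurve.XOrd₂.charIdeal (W.baseChange K) p κ₁ κ₂ γ₁ γ₂)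
      (perrinRiouLFunction W π F)) :
    SpanLeIdeal (perrinRiouLFunction W π F)
      (WeierstrassCurve.XOrd₂.charIdeal (W.baseChange K) p κ₁ κ₂ γ₁ γ₂) := by
  obtain ⟨C, hC⟩ := hW'
  -- `p ∤ d_K` (split), `p ≠ 2`, so the minimal model `W'` of `E^{(d_K)}` is good ordinary at `p`
  have hpd : ¬ (p : ℤ) ∣ NumberField.discr K :=
    not_dvd_discr_of_ncard_primesOver_eq_two hK.finrank_eq_two (Fact.out : p.Prime) hsplit
  have hord' : GoodOrd W' p :=
    isOrdinaryAt_of_smul_eq_quadraticTwist_discr hK.finrank_eq_two W W' hC p (by omega) hpd hord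
  exact spanLeIdeal_perrinRiou_of_facts_of_minimalTwist h49 h53 h37 ι W K κ₁ κ₂ γ₁ γ₂ π κ D D' ϖ W'
    g ϖ' hlevel hp hord hirr him hK hsplit hN hirrK hκ₁ hκ₂ hκ hγ hγ' hϖ ⟨C, hC⟩ hg hϖ' hord' hF hdiv

end YanZhu2026

end Literature.NumberTheory.EllipticCurves
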